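import Literature.MathematicalPhysics.QuantumManyBody.PeriodicWeightedMaxFormGroundStates
import HarnessLib

/-!
# Ground states of the maximal form of `-∑ⱼΔⱼ + W` (abstract weight): lower semicontinuity and the bridge
# to the closed form

Topic `Literature/MathematicalPhysics/QuantumManyBody`, sequel of `PeriodicWeightedMaxFormGroundStates.lean`;
abstract-weight twin of the last part of `PeriodicMaxFormGroundStates.lean` (same statements and proofs with
`periodicInteraction v L ↦ W`).

* `maxFormPotW_le_liminf_of_tendsto_ae`, `maxFormW_le_of_tendsto` — lower semicontinuity of the maximal form
  along `L²`-convergent sequences (Fatou along an a.e.-convergent subsequence; the weight is a.e. finite);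
* `formEmbedW_mem_boseSymmetric`, `maxFormW_formEmbedW_graphEmbedW`, `maxFormW_formEmbedW_le` — embedded classes
  are Bose-symmetric, the maximal form of an embedded core function is its energy integral, and on the form
  domain the maximal form is dominated by the closed form [Simon1979Forms, Thm. 2.1];
* `formEmbedW_mem_maxFormGroundStatesW_of_gramOp_eq` — **bridge**: the image of a top eigenvector of the Gram
  operator of the compact form embedding (`periodicGroundStateEnergyW = κ₁⁻¹ - 1`,
  `PeriodicWeightedFormSpectrum.lean`) is a ground state of the maximal form [ReedSimonIV1978, Thm. XIII.1, XIII.64].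

## References
* [ReedSimonIV1978] Reed–Simon IV, Thm. XIII.1, XIII.64, §XIII.12.
* [Simon1979Forms] B. Simon, J. Operator Theory 1 (1979) 37–47.
-/

noncomputable section

open MeasureTheory Filter Set WithLp Complex UnitAddTorus
open scoped ENNReal NNReal Topology ComplexConjugate InnerProductSpace
open Literature.Analysis.FunctionSpaces Literature.Analysis.OperatorTheory Literature.Analysis.InnerProduct

namespace Literature.MathematicalPhysics.QuantumManyBody.BoseGas

-- The measure on `ℝ/ℤ` is the Haar PROBABILITY measure, as in `PeriodicFormDomain.lean`.
attribute [local instance] formDomain_measureSpace formDomain_isProbabilityMeasure formDomain_isProbabilityMeasure_pi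

variable {N : ℕ} {L : ℝ} {W : Config N → ℝ≥0∞}

/-- Local notation for the Hilbert space `H = L²((ℝ/ℤ)^{3N})`. -/
local notation "L2T " N':max => Lp ℂ 2 (volume : Measure (UnitAddTorus (Fin N' × Fin 3)))

/-! ### Lower semicontinuity of the maximal form along `L²`-convergent sequences -/


/-- **The potential part is lower semicontinuous** along a.e.-convergent sequences (Fatou; the weight is
a.e. finite). [folklore] -/
theorem maxFormPotW_le_liminf_of_tendsto_ae (hL : 0 < L) (hWm : Measurable W)
    (hW : ∫⁻ X in cellN N L, W X ≠ ⊤) {x : ℕ → L2T N} {η : L2T N}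
    (hae : ∀ᵐ t ∂(volume : Measure (UnitAddTorus (Fin N × Fin 3))),
      Tendsto (fun j => (x j : UnitAddTorus (Fin N × Fin 3) → ℂ) t) atTop
        (𝓝 ((η : UnitAddTorus (Fin N × Fin 3) → ℂ) t))) :
    maxFormPotW W L η ≤ liminf (fun j => maxFormPotW W L (x j)) atTop := by
  unfold maxFormPotW
  have hfin : ∀ᵐ t ∂(volume : Measure (UnitAddTorus (Fin N × Fin 3))),
      W (fromUnitTorusN L t) < ⊤ :=
    ae_lt_top ((measurable_weight_fromUnitTorusN hWm L))
      (lintegral_weight_fromUnitTorusN_ne_top hL hWm hW)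
  calc ∫⁻ t, W (fromUnitTorusN L t) *
        ((‖(η : UnitAddTorus (Fin N × Fin 3) → ℂ) t‖₊ : ℝ≥0∞)) ^ 2
      = ∫⁻ t, liminf (fun j => W (fromUnitTorusN L t) *
          ((‖(x j : UnitAddTorus (Fin N × Fin 3) → ℂ) t‖₊ : ℝ≥0∞)) ^ 2) atTop := by
        refine lintegral_congr_ae ?_
        filter_upwards [hae, hfin] with t ht hWt
        have hcont : Continuous fun z : ℂ => ((‖z‖₊ : ℝ≥0∞)) ^ 2 :=
          (ENNReal.continuous_pow 2).comp (ENNReal.continuous_coe.comp continuous_nnnorm)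
        exact (ENNReal.Tendsto.const_mul ((hcont.tendsto _).comp ht) (Or.inr hWt.ne)).liminf_eq.symm
    _ ≤ _ := lintegral_liminf_le' fun j => aemeasurable_weight_integrand hWm L (x j)

/-- **Lower semicontinuity of the maximal form**: if `xⱼ → η` in `L²` and `maxFormW xⱼ ≤ cⱼ → C`, then
`maxFormW η ≤ C` (along an a.e.-convergent subsequence). [folklore] -/
theorem maxFormW_le_of_tendsto (hL : 0 < L) (hWm : Measurable W)
    (hW : ∫⁻ X in cellN N L, W X ≠ ⊤) {x : ℕ → L2T N} {η : L2T N}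
    (hx : Tendsto x atTop (𝓝 η)) {c : ℕ → ℝ≥0∞} {C : ℝ≥0∞} (hc : ∀ j, maxFormW W L (x j) ≤ c j)
    (hC : Tendsto c atTop (𝓝 C)) : maxFormW W L η ≤ C := by
  obtain ⟨φ, hφ, hae⟩ := (tendstoInMeasure_of_tendsto_Lp hx).exists_seq_tendsto_ae
  have hx' : Tendsto (x ∘ φ) atTop (𝓝 η) := hx.comp hφ.tendsto_atTop
  have hkin := maxFormKin_le_liminf L hx'
  have hpot := maxFormPotW_le_liminf_of_tendsto_ae hL hWm hW (x := x ∘ φ) hae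
  calc maxFormW W L η = maxFormKin L η + maxFormPotW W L η := rfl
    _ ≤ liminf (fun j => maxFormKin L ((x ∘ φ) j)) atTop + liminf (fun j => maxFormPotW W L ((x ∘ φ) j)) atTop :=
        add_le_add hkin hpot
    _ ≤ liminf (fun j => maxFormKin L ((x ∘ φ) j) + maxFormPotW W L ((x ∘ φ) j)) atTop :=
        liminf_add_liminf_le_ennreal _ _
    _ ≤ liminf (fun j => c (φ j)) atTop := liminf_le_liminf (Eventually.of_forall fun j => hc (φ j))
    _ = C := (hC.comp hφ.tendsto_atTop).liminf_eq

/-! ### The bridge to the closed form `Q` of `PeriodicFormDomain.lean` -/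

section Bridge

variable (hL : 0 < L) (hWm : Measurable W) (hW : ∫⁻ X in cellN N L, W X ≠ ⊤)

/-- **Embedded core functions are Bose-symmetric in momentum space** (Bose symmetry of `Ψ` is invariance
of `Ψ ∘ fromUnitTorusN` under the particle permutations of the torus coordinates). [folklore] -/

theorem formEmbedW_graphEmbedW_mem_boseSymmetric (Ψ : periodicCore N L) :
    formEmbedW hL hWm hW ⟨graphEmbedW hL hWm hW Ψ, graphEmbedW_mem_formDomainW hL hWm hW Ψ⟩ ∈ boseSymmetric N := by
  intro σ n
  set τ : Equiv.Perm (Fin N × Fin 3) := Equiv.prodCongr σ (Equiv.refl (Fin 3)) with hτ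
  have hτn : (fun i => n (τ i)) = fun p : Fin N × Fin 3 => n (σ p.1, p.2) := comp_prodCongr_eq σ n
  set f : L2T N := formEmbedW hL hWm hW ⟨graphEmbedW hL hWm hW Ψ, graphEmbedW_mem_formDomainW hL hWm hW Ψ⟩ with hf
  have hfc := coeFn_formEmbedW_graphEmbedW hL hWm hW Ψ
  have hF : ∀ t : UnitAddTorus (Fin N × Fin 3),
      (cellScale N L : ℂ) * (Ψ : Config N → ℂ) (fromUnitTorusN L (fun i => t (τ i))) =
        (cellScale N L : ℂ) * (Ψ : Config N → ℂ) (fromUnitTorusN L t) := by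
    intro t
    have hperm : fromUnitTorusN L (fun i => t (τ i)) = (fromUnitTorusN L t) ∘ σ := by
      funext i
      rfl
    rw [hperm, Ψ.2.2.2 σ]
  have hfcT : ∀ᵐ t ∂(volume : Measure (UnitAddTorus (Fin N × Fin 3))),
      (f : UnitAddTorus (Fin N × Fin 3) → ℂ) (fun i => t (τ i)) =
        (cellScale N L : ℂ) * (Ψ : Config N → ℂ) (fromUnitTorusN L (fun i => t (τ i))) := by
    have h := (measurePreserving_compPerm (D := Fin N × Fin 3) τ).quasiMeasurePreserving.ae_eq_comp hfc
    filter_upwards [h] with t ht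
    simpa only [Function.comp_apply, compPerm_apply] using ht
  have hfae : ∀ᵐ t ∂(volume : Measure (UnitAddTorus (Fin N × Fin 3))),
      (f : UnitAddTorus (Fin N × Fin 3) → ℂ) (fun i => t (τ i)) = (f : UnitAddTorus (Fin N × Fin 3) → ℂ) t := by
    filter_upwards [hfc, hfcT] with t h1 h2
    rw [h2, hF, h1]
  rw [← hτn]
  exact inner_symm_of_ae_eq_comp_perm f τ hfae n

/-- The embedded core functions converge to the embedded limit. [folklore] -/
theorem tendsto_formEmbedW_graphEmbedW {Ψ : ℕ → periodicCore N L} {u : formDomainW hL hWm hW}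
    (hΨ : Tendsto (fun j => graphEmbedW hL hWm hW (Ψ j)) atTop (𝓝 (u : PiLp 2 (fun _ : CompIdx N => L2T N)))) :
    Tendsto (fun j => formEmbedW hL hWm hW ⟨graphEmbedW hL hWm hW (Ψ j), graphEmbedW_mem_formDomainW hL hWm hW (Ψ j)⟩)
      atTop (𝓝 (formEmbedW hL hWm hW u)) := by
  change Tendsto (fun j => (PiLp.proj 2 (𝕜 := ℂ) (fun _ : CompIdx N => L2T N) (Sum.inl ())) (graphEmbedW hL hWm hW (Ψ j)))
    atTop (𝓝 ((PiLp.proj 2 (𝕜 := ℂ) (fun _ : CompIdx N => L2T N) (Sum.inl ())) (u : PiLp 2 (fun _ : CompIdx N => L2T N))))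
  exact ((PiLp.proj 2 (𝕜 := ℂ) (fun _ : CompIdx N => L2T N) (Sum.inl ())).continuous.tendsto _).comp hΨ

/-- **Every class of the form domain is Bose-symmetric in momentum space** (the Bose sector is closed).
[folklore] -/
theorem formEmbedW_mem_boseSymmetric (u : formDomainW hL hWm hW) : formEmbedW hL hWm hW u ∈ boseSymmetric N := by
  obtain ⟨Ψ, hΨ⟩ := exists_seq_tendsto_of_mem_formDomainW hL hWm hW u
  exact isClosed_boseSymmetric.mem_of_tendsto (tendsto_formEmbedW_graphEmbedW hL hWm hW hΨ)
    (Eventually.of_forall fun j => formEmbedW_graphEmbedW_mem_boseSymmetric hL hWm hW (Ψ j))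

/-- **The maximal form of an embedded core function is its energy integral**
`∫_{[0,L)^{3N}} |∇Ψ|² + W|Ψ|²`. [cite: Simon1979Forms, Thm. 2.1] -/
theorem maxFormW_formEmbedW_graphEmbedW (Ψ : periodicCore N L) :
    maxFormW W L (formEmbedW hL hWm hW ⟨graphEmbedW hL hWm hW Ψ, graphEmbedW_mem_formDomainW hL hWm hW Ψ⟩) =
      ∫⁻ X in cellN N L, kineticDensity (Ψ : Config N → ℂ) X +
        W X * ((‖(Ψ : Config N → ℂ) X‖₊ : ℝ≥0∞)) ^ 2 := by
  rw [maxFormW, maxFormKin, maxFormPotW, tsum_kinetic_formEmbedW_graphEmbedW hL hWm hW Ψ,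
    lintegral_pot_formEmbedW_graphEmbedW hL hWm hW Ψ hWm,
    ← lintegral_add_left (measurable_kineticDensity_any _)]

/-- For a core function, `maxFormW (ιΨ) = ‖graphEmbedW Ψ‖² - ‖ιΨ‖²` (finite). [cite: Simon1979Forms, Thm. 2.1] -/
theorem maxFormW_formEmbedW_graphEmbedW_eq_ofReal (Ψ : periodicCore N L) :
    maxFormW W L (formEmbedW hL hWm hW ⟨graphEmbedW hL hWm hW Ψ, graphEmbedW_mem_formDomainW hL hWm hW Ψ⟩) =
      ENNReal.ofReal (‖graphEmbedW hL hWm hW Ψ‖ ^ 2 -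
        ‖formEmbedW hL hWm hW ⟨graphEmbedW hL hWm hW Ψ, graphEmbedW_mem_formDomainW hL hWm hW Ψ⟩‖ ^ 2) := by
  rw [maxFormW_formEmbedW_graphEmbedW, norm_graphEmbedW_sq hL hWm hW Ψ, norm_formEmbedW_graphEmbedW_sq hL hWm hW Ψ,
    add_sub_cancel_left, ENNReal.ofReal_toReal (lintegral_energyW_lt_top hWm hW Ψ.2.1).ne]

/-- **The maximal form is dominated by the closed form on the form domain**:
`maxFormW (ι u) ≤ ‖u‖²_Q - ‖ι u‖²` for every `u ∈ Q` (lower semicontinuity along core approximants; in fact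
an equality, Simon's "maximal form = minimal form", not needed here). [cite: Simon1979Forms, Thm. 2.1] -/
theorem maxFormW_formEmbedW_le (u : formDomainW hL hWm hW) :
    maxFormW W L (formEmbedW hL hWm hW u) ≤ ENNReal.ofReal (‖u‖ ^ 2 - ‖formEmbedW hL hWm hW u‖ ^ 2) := by
  obtain ⟨Ψ, hΨ⟩ := exists_seq_tendsto_of_mem_formDomainW hL hWm hW u
  have hx := tendsto_formEmbedW_graphEmbedW hL hWm hW hΨ
  have hnormQ : Tendsto (fun j => ‖graphEmbedW hL hWm hW (Ψ j)‖) atTop (𝓝 ‖u‖) :=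
    (continuous_norm.tendsto _).comp hΨ
  have hnormH : Tendsto (fun j => ‖formEmbedW hL hWm hW ⟨graphEmbedW hL hWm hW (Ψ j),
      graphEmbedW_mem_formDomainW hL hWm hW (Ψ j)⟩‖) atTop (𝓝 ‖formEmbedW hL hWm hW u‖) :=
    (continuous_norm.tendsto _).comp hx
  refine maxFormW_le_of_tendsto hL hWm hW hx
    (c := fun j => ENNReal.ofReal (‖graphEmbedW hL hWm hW (Ψ j)‖ ^ 2 -
      ‖formEmbedW hL hWm hW ⟨graphEmbedW hL hWm hW (Ψ j), graphEmbedW_mem_formDomainW hL hWm hW (Ψ j)⟩‖ ^ 2))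
    (fun j => (maxFormW_formEmbedW_graphEmbedW_eq_ofReal hL hWm hW (Ψ j)).le) ?_
  exact (ENNReal.continuous_ofReal.tendsto _).comp ((hnormQ.pow 2).sub (hnormH.pow 2))

/-- **Bridge: variational ground states are ground states of the maximal form.** If `u ∈ Q` is an
eigenvector of the Gram operator `ι†ι` of the form embedding for its top eigenvalue `κ₁`
(`periodicGroundStateEnergyW W L = κ₁⁻¹ - 1`, `PeriodicFormSpectrum.lean`), then `ι u` lies in
`maxFormGroundStatesW W L`. [cite: ReedSimonIV1978, Thm. XIII.1 and XIII.64] -/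
theorem formEmbedW_mem_maxFormGroundStatesW_of_gramOp_eq (d : TwoModeData (formEmbedW hL hWm hW))
    {u : formDomainW hL hWm hW} (hu : gramOp (formEmbedW hL hWm hW) u = (d.κ₁ : ℂ) • u) :
    formEmbedW hL hWm hW u ∈ maxFormGroundStatesW W L := by
  refine ⟨formEmbedW_mem_boseSymmetric hL hWm hW u, ?_⟩
  have h1 := maxFormW_formEmbedW_le hL hWm hW u
  have h2 : ‖formEmbedW hL hWm hW u‖ ^ 2 = d.κ₁ * ‖u‖ ^ 2 := norm_map_sq_of_gramOp_eq_smul (formEmbedW hL hWm hW) hu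
  have hκ := d.κ₁_pos
  rw [periodicGroundStateEnergyW_eq_ofReal d,
    ← ENNReal.ofReal_mul (by linarith [twoModeDataW_one_le_inv_κ₁ d] : 0 ≤ d.κ₁⁻¹ - 1)]
  refine h1.trans (le_of_eq ?_)
  congr 1
  rw [h2]
  field_simp

end Bridge
end Literature.MathematicalPhysics.QuantumManyBody.BoseGas

end
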